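import Summits.NavierStokesRegularity.NavierStokesRegularity.Theses.StretchingWellBinding
import Summits.NavierStokesRegularity.NavierStokesRegularity.Theses.TypeILiouville
import Summits.NavierStokesRegularity.NavierStokesRegularity.Theorems.StretchingWellBindingEnstrophyQuarterLawGradientTypeI
import Summits.NavierStokesRegularity.NavierStokesRegularity.Theorems.StretchingWellBindingEnstrophyQuarterLawStretchingSplit
import Literature.Analysis.FluidPDE.VorticityCalculus
import Mathlib.Analysis.SpecialFunctions.Pow.Deriv
import Mathlib.Analysis.Calculus.MeanValue
import HarnessLib.Audit

/-!
# Line «lamb_budget» — TWIN FORM (appendix): the quarter law is Type I plus volume sparseness of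
# the HIGH-VORTICITY set (stretching split; no Lamb identity, no Sobolev, no dissipation needed)

Appendix workfile of `Lines/lamb_budget.lean` on crux `EnstrophyQuarterLaw` (stmt-NavierStokesRegularity-1574),
ideator seat ns-idea-9 generation 3. SAME LEVER as the main file (threshold absorption of the enstrophy
production localised to a super-level set), different OBSERVABLE: the vorticity super-level set
`W_{c₂}(s) = {x : |curl u(x,s)| > c₂/(T−s)}` instead of the velocity fast set. It is filed as a twin of
LINE 7, not as a separate line (distinctness test: one lever = one line).

ENGINE (stub `stub_stretchingSplit`, provable, M): with `Z = ∫|ω|²`, the tree's PROVED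
`EfficiencyFloor.EnstrophyBudget` (stmt-22995) gives `Z′ = 2∫ω·Sω − 2νP ≤ 2∫ω·Sω`. On the LOW set
`|ω| ≤ c₂/(T−s)`: `|ω·Sω| ≤ (c₂/(T−s))|ω||S|`, so its contribution is `≤ (c₂/(T−s))‖ω‖₂‖S‖₂ = c₂Z/(√2(T−s))`
(`‖S‖₂² = Z/2` for divergence-free decaying fields) — absorbed by the factor `(T−s)^{√2 c₂}` iff
`√2 c₂ < 1/2`; we fix the admissible range as `c₂ < 1/4`. On the HIGH set, under the Type-I GRADIENT bound
`|∇u| ≤ C/(T−s)` (hence `|ω|, |S| ≲ C/(T−s)`): `∫_W |ω|²|S| ≤ |W(s)|·C³(T−s)⁻³`, and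
`|W(s)| ≤ N(ν(T−s))^{3/2}` gives `O((T−s)^{−3/2})`, whence `Z(t) ≤ K/√(T−t)`: the quarter law. NOTHING ELSE
is used (not even the dissipation term). CONVERSE (PROVED here, no sorry: `vorticitySparse_of_sliceLaw`):
`Z(s) ≤ K/√(T−s)` ⇒ `|W(s)| ≤ Z(T−s)²/c₂² ≤ (K/c₂²)(T−s)^{3/2}` (Chebyshev). NET, per solution and for
every `c₂ ∈ (0,1/4)`: `SliceLaw ⟺ GradientTypeI-rate ∧ VorticitySparse c₂` modulo the provable split and
the known `stub_gradientTypeI`; at shelf level `EnstrophyQuarterLaw ⟺ 0056 ∧ VorticitySparsenessLaw`.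

THE METHOD'S OWN LADDER (why the half power is exactly the open content). Under vorticity Type I alone,
`Z(t) ≤ ‖ω(t)‖_∞‖ω(t)‖_{L¹} ≤ (C/(T−t))·(‖ω₀‖₁ + E₀/ν)` since `d/dt‖ω‖₁ ≤ ∫|ω||∇u| ≤ Z` (Constantin
1990's elementary `L¹`-vorticity bound): the HALF LAW `Z = O((T−t)⁻¹)` is cheap (also reproduced by the
velocity engine of the main file with the ENERGY Chebyshev bound `|F| ≤ 2E₀(T−s)/(c₀²ν)` in place of B).
`L¹ × L^∞` is sharp exactly on two-valued vorticity of height `~(T−t)⁻¹` on volume `~(T−t)` — the negation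
of `VorticitySparse`. So inside this method: exponent `M²/2` (Grönwall) → `1` (known) → `1/2` ⟺ B_ω / B.

No summit is proved by this file; `EnstrophyQuarterLaw`, stmt-0056 and `VorticitySparsenessLaw` stay OPEN.
`lean check`: rc 0, `sorry` exactly in the four `stub_*`; `vorticitySparse_of_sliceLaw` and the
compositions are real proofs.

WIRING 2026-08-28 (ns-hhe-c1 g5, statements byte-identical): `stub_stretchingSplit` and `stub_gradientTypeI` are
CLOSED BY NAME by the landed Theorems files `…EnstrophyQuarterLawStretchingSplit` (`LambBudget.stretchingSplit`, with
tools `…StretchingSplitODE` / `…StretchingSplitSlice`) and `…EnstrophyQuarterLawGradientTypeI`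
(`LambBudget.gradientTypeIOfTypeI`), all `--supports stmt-NavierStokesRegularity-1574`; the by-name closure
`EnstrophyQuarterLaw ⟺ 0056 ∧ B_ω` is `LambBudget.enstrophyQuarterLaw_iff_noTypeII_and_vorticitySparsenessLaw`
(`…LambBudgetVorticityAssembly`). `sorry` now remains exactly in `stub_noTypeII` (= stmt-0056, OPEN) and
`stub_vorticitySparseness` (= B_ω, OPEN). No summit is proved by this file; `EnstrophyQuarterLaw` (1574) stays OPEN.
-/

set_option linter.dupNamespace false

namespace Summit.NavierStokesRegularity.NavierStokesRegularity.Cruxes.EnstrophyQuarterLaw.LambBudget.Vorticity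

open MeasureTheory Set
open scoped ENNReal NNReal
open Literature.Analysis.FluidPDE

/-- The high-vorticity set at the self-similar vorticity threshold `c₂/(T−s)`. -/
def vortexSet (c₂ T : ℝ) (u : ℝ → EuclideanSpace ℝ (Fin 3) → EuclideanSpace ℝ (Fin 3)) (s : ℝ) :
    Set (EuclideanSpace ℝ (Fin 3)) :=
  {x | c₂ / (T - s) < ‖curl (u s) x‖}

/-- VOLUME SPARSENESS of the high-vorticity set: boundedly many parabolic cells by Lebesgue measure. -/
def VorticitySparse (c₂ ν T : ℝ) (u : ℝ → EuclideanSpace ℝ (Fin 3) → EuclideanSpace ℝ (Fin 3)) : Prop :=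
  ∃ N : ℝ, ∀ s ∈ Set.Ico 0 T,
    volume (vortexSet c₂ T u s) ≤ ENNReal.ofReal (N * Real.sqrt (ν * (T - s)) ^ 3)

/-- The slice quarter law for one solution (the conclusion of `EnstrophyQuarterLaw`, verbatim). -/
def SliceLaw (T : ℝ) (u : ℝ → EuclideanSpace ℝ (Fin 3) → EuclideanSpace ℝ (Fin 3)) : Prop :=
  ∃ K : ℝ, ∀ t ∈ Set.Ico 0 T, ∫⁻ x, ‖curl (u t) x‖ₑ ^ 2 ≤ ENNReal.ofReal (K / Real.sqrt (T - t))

/-- Type-I rate for the velocity GRADIENT near `T` (a known consequence of the sup-norm Type-I rate). -/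
def GradientTypeI (T : ℝ) (u : ℝ → EuclideanSpace ℝ (Fin 3) → EuclideanSpace ℝ (Fin 3)) : Prop :=
  ∃ C : ℝ, ∀ᶠ t in nhdsWithin T (Set.Iio T), ∀ x, ‖fderiv ℝ (u t) x‖ ≤ C / (T - t)

/-- NEW CRUX B_ω (twin of `VolumeSparsenessLaw`): at every first blow-up from rapidly decaying data the
high-vorticity set `{|ω(s)| > c₂/(T−s)}` has measure `≤ N(ν(T−s))^{3/2}`, for some `c₂ ∈ (0, 1/4)`. -/
def VorticitySparsenessLaw : Prop :=
  ∃ c₂ : ℝ, 0 < c₂ ∧ c₂ < 1 / 4 ∧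
    ∀ (ν T : ℝ), 0 < ν → 0 < T →
    ∀ (u : ℝ → EuclideanSpace ℝ (Fin 3) → EuclideanSpace ℝ (Fin 3)) (p : ℝ → EuclideanSpace ℝ (Fin 3) → ℝ),
      IsMaximalSmoothSolution ν 0 u p T → IsLerayHopfOn T ν 0 (u 0) u → HasRapidSpatialDecay (u 0) →
      VorticitySparse c₂ ν T u

/-- ENGINE (provable, M): the stretching split. Gradient Type I + vorticity volume sparseness at a threshold
`c₂ < 1/4` ⇒ the slice quarter law (low set absorbed: `√2 c₂ < 1/2`; high set: measure × sup³). -/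
def StretchingSplit : Prop :=
  ∀ c₂ : ℝ, 0 < c₂ → c₂ < 1 / 4 →
    ∀ (ν T : ℝ), 0 < ν → 0 < T →
    ∀ (u : ℝ → EuclideanSpace ℝ (Fin 3) → EuclideanSpace ℝ (Fin 3)) (p : ℝ → EuclideanSpace ℝ (Fin 3) → ℝ),
      IsMaximalSmoothSolution ν 0 u p T → IsLerayHopfOn T ν 0 (u 0) u → HasRapidSpatialDecay (u 0) →
      GradientTypeI T u → VorticitySparse c₂ ν T u → SliceLaw T u

/-- KNOWN (M–L to vendor): the sup-norm Type-I rate gives the gradient Type-I rate near `T`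
(L^∞ parabolic smoothing; in tree `PineauVicol2026.exists_forall_iteratedFDeriv_le_of_bounded`). -/
def GradientTypeIOfTypeI : Prop :=
  ∀ (ν T : ℝ), 0 < ν → 0 < T →
    ∀ (u : ℝ → EuclideanSpace ℝ (Fin 3) → EuclideanSpace ℝ (Fin 3)) (p : ℝ → EuclideanSpace ℝ (Fin 3) → ℝ),
      IsMaximalSmoothSolution ν 0 u p T → IsLerayHopfOn T ν 0 (u 0) u → HasRapidSpatialDecay (u 0) →
      IsTypeIBlowup u T → GradientTypeI T u

-- CLOSED 2026-08-28 (ns-hhe-c1 g5): the landed engine, predicates unfolded (defeq).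
theorem stub_stretchingSplit : StretchingSplit :=
  Summit.NavierStokesRegularity.NavierStokesRegularity.Theorems.EnstrophyQuarterLaw.LambBudget.stretchingSplit

theorem stub_noTypeII : Theses.TypeILiouville.TypeIliouvilleNoTypeII := by
  sorry

-- CLOSED 2026-08-28 (ns-hhe-c1 g5): the landed KNSS-zoom lemma, predicate unfolded (defeq).
theorem stub_gradientTypeI : GradientTypeIOfTypeI :=
  Summit.NavierStokesRegularity.NavierStokesRegularity.Theorems.EnstrophyQuarterLaw.LambBudget.gradientTypeIOfTypeI

theorem stub_vorticitySparseness : VorticitySparsenessLaw := by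
  sorry

/-- **PROVED (no sorry): the quarter law forces vorticity volume sparseness at EVERY threshold** —
Chebyshev at the single level `c₂/(T−s)`: `|W(s)| ≤ Z(s)(T−s)²/c₂² ≤ (K/c₂²)(T−s)^{3/2}`. -/
theorem vorticitySparse_of_sliceLaw {c₂ ν T : ℝ} (hc₂ : 0 < c₂) (hν : 0 < ν)
    {u : ℝ → EuclideanSpace ℝ (Fin 3) → EuclideanSpace ℝ (Fin 3)} {p : ℝ → EuclideanSpace ℝ (Fin 3) → ℝ}
    (hmax : IsMaximalSmoothSolution ν 0 u p T) (hZ : SliceLaw T u) : VorticitySparse c₂ ν T u := by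
  obtain ⟨K, hK⟩ := hZ
  refine ⟨max K 0 / (c₂ ^ 2 * Real.sqrt ν ^ 3), fun s hs => ?_⟩
  have hTs : 0 < T - s := sub_pos.2 hs.2
  have hr : 0 < Real.sqrt (T - s) := Real.sqrt_pos.2 hTs
  have hsν : 0 < Real.sqrt ν := Real.sqrt_pos.2 hν
  set lam : ℝ := c₂ / (T - s) with hlam
  have hlam_pos : 0 < lam := div_pos hc₂ hTs
  -- measurability of the slice integrand from smoothness of the classical slice
  have hC1 : ContDiff ℝ 1 (u s) :=
    ((hmax.isClassicalNSSolutionOn.contDiff_velocity hs).of_le (by norm_cast))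
  have hmeas : AEMeasurable (fun x => ‖curl (u s) x‖ₑ ^ 2) volume :=
    ((continuous_curl hC1).measurable.enorm.pow_const 2).aemeasurable
  -- Chebyshev at the level `lam²`
  have hsub : vortexSet c₂ T u s ⊆ {x | ENNReal.ofReal (lam ^ 2) ≤ ‖curl (u s) x‖ₑ ^ 2} := by
    intro x hx
    simp only [vortexSet, Set.mem_setOf_eq] at hx ⊢
    rw [← ofReal_norm, ← ENNReal.ofReal_pow (norm_nonneg _)]
    exact ENNReal.ofReal_le_ofReal (by nlinarith [hlam_pos, hx, norm_nonneg (curl (u s) x)])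
  have hε0 : ENNReal.ofReal (lam ^ 2) ≠ 0 := (ENNReal.ofReal_pos.2 (pow_pos hlam_pos 2)).ne'
  have hcheb := meas_ge_le_lintegral_div hmeas hε0 ENNReal.ofReal_ne_top
  have hW : volume (vortexSet c₂ T u s) ≤ ENNReal.ofReal (K / Real.sqrt (T - s)) / ENNReal.ofReal (lam ^ 2) :=
    (measure_mono hsub).trans (hcheb.trans (ENNReal.div_le_div_right (hK s hs) _))
  refine hW.trans ?_
  rw [← ENNReal.ofReal_div_of_pos (pow_pos hlam_pos 2)]
  apply ENNReal.ofReal_le_ofReal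
  -- real arithmetic: K/√(T−s)/lam² = K (√(T−s))³ / c₂²  ≤  maxK0/(c₂² √ν³) · (√ν √(T−s))³
  have hsplit : Real.sqrt (ν * (T - s)) = Real.sqrt ν * Real.sqrt (T - s) := Real.sqrt_mul hν.le _
  rw [hsplit, hlam]
  have hc2 : 0 < c₂ ^ 2 := pow_pos hc₂ 2
  set r := Real.sqrt (T - s) with hr_def
  have hTs' : T - s = r ^ 2 := (Real.sq_sqrt hTs.le).symm
  have hr0 : r ≠ 0 := hr.ne'
  have hc0 : c₂ ≠ 0 := hc₂.ne'
  have hν0 : Real.sqrt ν ≠ 0 := hsν.ne'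
  rw [hTs']
  calc K / r / (c₂ / r ^ 2) ^ 2
        = K * r ^ 3 / c₂ ^ 2 := by
          field_simp
    _ ≤ max K 0 * r ^ 3 / c₂ ^ 2 := by
          gcongr
          exact le_max_left _ _
    _ = max K 0 / (c₂ ^ 2 * Real.sqrt ν ^ 3) * (Real.sqrt ν * r) ^ 3 := by
          field_simp


/-! ## The analytic core of both engines, PROVED: threshold absorption ⇒ the slice quarter law

Pure real analysis (no Navier–Stokes input). With the integrating factor `(T−s)^a`, `a < 1/2`, the function
`h(s) = (T−s)^a Z(s) − (C/(1/2−a))(T−s)^{a−1/2}` is non-increasing on `[0,T)`, whence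
`Z(t) ≤ (√T·Z(0) + C/(1/2−a))/√(T−t)`. For `a ≥ 1/2` the comparison function is no longer singular at `T` and only
`Z = O((T−t)^{−a})` comes out — this is the precise place where `c₀ < 1` (main file) / `√2·c₂ < 1/2` (twin) bite. -/

/-- **Threshold absorption ⇒ quarter law (PROVED).** If `Z ≥ 0` is continuous on `[0,T)`, differentiable on
`(0,T)` with `Z′(s) ≤ a·Z(s)/(T−s) + C·(T−s)^{−3/2}` where `0 ≤ a < 1/2` and `0 ≤ C`, then
`Z(t) ≤ (√T·Z(0) + C/(1/2−a))/√(T−t)` on `[0,T)`. -/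
theorem sliceBound_of_absorbedGrowth {T a C : ℝ} (hT : 0 < T) (ha : a < 1 / 2) (hC : 0 ≤ C)
    {Z dZ : ℝ → ℝ} (hcont : ContinuousOn Z (Ico 0 T)) (hderiv : ∀ s ∈ Ioo 0 T, HasDerivAt Z (dZ s) s)
    (hnn : ∀ s ∈ Ico 0 T, 0 ≤ Z s)
    (hgrowth : ∀ s ∈ Ioo 0 T, dZ s ≤ a * Z s / (T - s) + C * (T - s) ^ (-(3 : ℝ) / 2)) :
    ∀ t ∈ Ico 0 T, Z t ≤ (Real.sqrt T * Z 0 + C / (1 / 2 - a)) / Real.sqrt (T - t) := by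
  intro t ht
  have hTt : 0 < T - t := sub_pos.2 ht.2
  set K₂ : ℝ := C / (1 / 2 - a) with hK₂
  have hgap : 0 < 1 / 2 - a := by linarith
  have hK₂nn : 0 ≤ K₂ := div_nonneg hC hgap.le
  -- the comparison function
  set h : ℝ → ℝ := fun s => (T - s) ^ a * Z s - K₂ * (T - s) ^ (a - 1 / 2) with hh
  -- derivative of h on (0,T)
  have hderivh : ∀ s ∈ Ioo 0 T, HasDerivAt h
      ((-1 * a * (T - s) ^ (a - 1)) * Z s + (T - s) ^ a * dZ s
        - K₂ * (-1 * (a - 1 / 2) * (T - s) ^ (a - 1 / 2 - 1))) s := by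
    intro s hs
    have hTs : 0 < T - s := sub_pos.2 hs.2
    have hb : HasDerivAt (fun x => T - x) (-1) s := by
      simpa using (hasDerivAt_id s).const_sub T
    have hp : HasDerivAt (fun x => (T - x) ^ a) (-1 * a * (T - s) ^ (a - 1)) s :=
      hb.rpow_const (Or.inl hTs.ne')
    have hq : HasDerivAt (fun x => (T - x) ^ (a - 1 / 2)) (-1 * (a - 1 / 2) * (T - s) ^ (a - 1 / 2 - 1)) s :=
      hb.rpow_const (Or.inl hTs.ne')
    exact (hp.mul (hderiv s hs)).sub (hq.const_mul K₂)
  -- sign of the derivative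
  have hderivh_nonpos : ∀ s ∈ Ioo 0 T,
      (-1 * a * (T - s) ^ (a - 1)) * Z s + (T - s) ^ a * dZ s
        - K₂ * (-1 * (a - 1 / 2) * (T - s) ^ (a - 1 / 2 - 1)) ≤ 0 := by
    intro s hs
    have hTs : 0 < T - s := sub_pos.2 hs.2
    have hZs : 0 ≤ Z s := hnn s ⟨hs.1.le, hs.2⟩
    have hpa : 0 ≤ (T - s) ^ a := Real.rpow_nonneg hTs.le a
    have h1 : (T - s) ^ a * dZ s ≤ (T - s) ^ a * (a * Z s / (T - s) + C * (T - s) ^ (-(3 : ℝ) / 2)) :=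
      mul_le_mul_of_nonneg_left (hgrowth s hs) hpa
    have e1 : (T - s) ^ a * (a * Z s / (T - s)) = a * (T - s) ^ (a - 1) * Z s := by
      rw [Real.rpow_sub_one hTs.ne']
      field_simp
    have e2 : (T - s) ^ a * (C * (T - s) ^ (-(3 : ℝ) / 2)) = C * (T - s) ^ (a - 1 / 2 - 1) := by
      have : a - 1 / 2 - 1 = a + (-(3 : ℝ) / 2) := by ring
      rw [this, Real.rpow_add hTs]
      ring
    have e3 : K₂ * (-1 * (a - 1 / 2) * (T - s) ^ (a - 1 / 2 - 1)) = C * (T - s) ^ (a - 1 / 2 - 1) := by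
      have hK₂C : K₂ * (1 / 2 - a) = C := by
        rw [hK₂]; exact div_mul_cancel₀ C hgap.ne'
      calc K₂ * (-1 * (a - 1 / 2) * (T - s) ^ (a - 1 / 2 - 1))
            = (K₂ * (1 / 2 - a)) * (T - s) ^ (a - 1 / 2 - 1) := by ring
        _ = C * (T - s) ^ (a - 1 / 2 - 1) := by rw [hK₂C]
    rw [e3]
    have h2 : (T - s) ^ a * dZ s ≤ a * (T - s) ^ (a - 1) * Z s + C * (T - s) ^ (a - 1 / 2 - 1) := by
      calc (T - s) ^ a * dZ s ≤ (T - s) ^ a * (a * Z s / (T - s) + C * (T - s) ^ (-(3 : ℝ) / 2)) := h1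
        _ = a * (T - s) ^ (a - 1) * Z s + C * (T - s) ^ (a - 1 / 2 - 1) := by rw [mul_add, e1, e2]
    linarith [h2]
  -- h is antitone on [0, t]
  have htT : Icc 0 t ⊆ Ico 0 T := fun s hs => ⟨hs.1, hs.2.trans_lt ht.2⟩
  have hcont_h : ContinuousOn h (Icc 0 t) := by
    have hb : ContinuousOn (fun s : ℝ => T - s) (Icc 0 t) := (continuous_const.sub continuous_id).continuousOn
    have hne : ∀ s ∈ Icc 0 t, T - s ≠ 0 ∨ 0 ≤ a := fun s hs => Or.inl (sub_pos.2 (hs.2.trans_lt ht.2)).ne'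
    have hne' : ∀ s ∈ Icc 0 t, T - s ≠ 0 ∨ 0 ≤ a - 1 / 2 := fun s hs =>
      Or.inl (sub_pos.2 (hs.2.trans_lt ht.2)).ne'
    exact ((hb.rpow_const hne).mul (hcont.mono htT)).sub ((hb.rpow_const hne').const_smul K₂ |>.congr
      (fun s _ => by simp [smul_eq_mul]))
  have hanti : AntitoneOn h (Icc 0 t) := by
    apply antitoneOn_of_deriv_nonpos (convex_Icc 0 t) hcont_h
    · rw [interior_Icc]
      intro s hs
      exact (hderivh s ⟨hs.1, hs.2.trans ht.2⟩).differentiableAt.differentiableWithinAt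
    · rw [interior_Icc]
      intro s hs
      rw [(hderivh s ⟨hs.1, hs.2.trans ht.2⟩).deriv]
      exact hderivh_nonpos s ⟨hs.1, hs.2.trans ht.2⟩
  have hmain : h t ≤ h 0 := hanti (left_mem_Icc.2 ht.1) (right_mem_Icc.2 ht.1) ht.1
  -- unfold and finish with real arithmetic
  have hZ0 : 0 ≤ Z 0 := hnn 0 ⟨le_rfl, hT⟩
  have hZt : 0 ≤ Z t := hnn t ht
  simp only [hh, sub_zero] at hmain
  -- hmain : (T - t) ^ a * Z t - K₂ * (T - t) ^ (a - 1/2) ≤ T ^ a * Z 0 - K₂ * T ^ (a - 1/2)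
  have hpa : 0 < (T - t) ^ a := Real.rpow_pos_of_pos hTt a
  have hq_t : 0 < (T - t) ^ (a - 1 / 2) := Real.rpow_pos_of_pos hTt _
  have hq_T : 0 ≤ T ^ (a - 1 / 2) := Real.rpow_nonneg hT.le _
  -- T^a Z0 ≤ √T Z0 (T-t)^(a-1/2)
  have hTa : T ^ a = Real.sqrt T * T ^ (a - 1 / 2) := by
    rw [Real.sqrt_eq_rpow, ← Real.rpow_add hT]
    norm_num
  have hmono : T ^ (a - 1 / 2) ≤ (T - t) ^ (a - 1 / 2) :=
    Real.rpow_le_rpow_of_nonpos hTt (by linarith [ht.1]) (by linarith)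
  have step1 : (T - t) ^ a * Z t ≤ (Real.sqrt T * Z 0 + K₂) * (T - t) ^ (a - 1 / 2) := by
    have : T ^ a * Z 0 ≤ Real.sqrt T * Z 0 * (T - t) ^ (a - 1 / 2) := by
      rw [hTa]
      have hs0 : 0 ≤ Real.sqrt T * Z 0 := mul_nonneg (Real.sqrt_nonneg _) hZ0
      nlinarith [mul_le_mul_of_nonneg_left hmono hs0]
    nlinarith [hmain, this, mul_nonneg hK₂nn hq_T]
  -- divide by (T - t)^a and rewrite (T-t)^(a-1/2) / (T-t)^a = 1/√(T-t)
  have hsplit : (T - t) ^ (a - 1 / 2) = (T - t) ^ a * (Real.sqrt (T - t))⁻¹ := by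
    rw [Real.sqrt_eq_rpow, ← Real.rpow_neg hTt.le, ← Real.rpow_add hTt]
    norm_num
    ring_nf
  rw [hsplit] at step1
  have hsq : 0 < Real.sqrt (T - t) := Real.sqrt_pos.2 hTt
  rw [le_div_iff₀ hsq]
  have step2 : (T - t) ^ a * (Z t * Real.sqrt (T - t)) ≤ (T - t) ^ a * (Real.sqrt T * Z 0 + K₂) := by
    have := step1
    calc (T - t) ^ a * (Z t * Real.sqrt (T - t))
          = ((T - t) ^ a * Z t) * Real.sqrt (T - t) := by ring
      _ ≤ ((Real.sqrt T * Z 0 + K₂) * ((T - t) ^ a * (Real.sqrt (T - t))⁻¹)) * Real.sqrt (T - t) :=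
            mul_le_mul_of_nonneg_right this hsq.le
      _ = (T - t) ^ a * (Real.sqrt T * Z 0 + K₂) := by field_simp
  exact le_of_mul_le_mul_left step2 hpa

/-- **Corollary (PROVED): the slice quarter law from the absorbed growth inequality for the enstrophy.**
If the real-valued enstrophy `Z(s) = (∫⁻ ‖curl u(s)‖ₑ²).toReal` is finite and continuous on `[0,T)`, differentiable
on `(0,T)` with `Z′ ≤ aZ/(T−s) + C(T−s)^{−3/2}`, `a < 1/2`, then `SliceLaw T u`. This is exactly what the prover of
`StretchingSplit` (and, in the main file, of stub 1 in pointwise form) has left after the pointwise split estimate: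
`a = √2·c₂ < 1/2` from the low-vorticity set, `C = M_ω³·N·ν^{3/2}·(const)` from the sparse high set. -/
theorem sliceLaw_of_absorbedEnstrophyGrowth {T a C : ℝ} (hT : 0 < T) (ha : a < 1 / 2) (hC : 0 ≤ C)
    {u : ℝ → EuclideanSpace ℝ (Fin 3) → EuclideanSpace ℝ (Fin 3)} {dZ : ℝ → ℝ}
    (hfin : ∀ s ∈ Ico 0 T, ∫⁻ x, ‖curl (u s) x‖ₑ ^ 2 < ⊤)
    (hcont : ContinuousOn (fun s => (∫⁻ x, ‖curl (u s) x‖ₑ ^ 2).toReal) (Ico 0 T))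
    (hderiv : ∀ s ∈ Ioo 0 T, HasDerivAt (fun s => (∫⁻ x, ‖curl (u s) x‖ₑ ^ 2).toReal) (dZ s) s)
    (hgrowth : ∀ s ∈ Ioo 0 T,
      dZ s ≤ a * (∫⁻ x, ‖curl (u s) x‖ₑ ^ 2).toReal / (T - s) + C * (T - s) ^ (-(3 : ℝ) / 2)) :
    SliceLaw T u := by
  set Z : ℝ → ℝ := fun s => (∫⁻ x, ‖curl (u s) x‖ₑ ^ 2).toReal with hZ
  have hnn : ∀ s ∈ Ico 0 T, 0 ≤ Z s := fun s _ => ENNReal.toReal_nonneg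
  have hb := sliceBound_of_absorbedGrowth hT ha hC hcont hderiv hnn hgrowth
  refine ⟨Real.sqrt T * Z 0 + C / (1 / 2 - a), fun t ht => ?_⟩
  calc ∫⁻ x, ‖curl (u t) x‖ₑ ^ 2 = ENNReal.ofReal (Z t) := (ENNReal.ofReal_toReal (hfin t ht).ne).symm
    _ ≤ ENNReal.ofReal ((Real.sqrt T * Z 0 + C / (1 / 2 - a)) / Real.sqrt (T - t)) :=
        ENNReal.ofReal_le_ofReal (hb t ht)

/-- Composition (real proof): the twin stubs deliver the crux BY NAME. -/
theorem EnstrophyQuarterLaw_of (hS : StretchingSplit) (hII : Theses.TypeILiouville.TypeIliouvilleNoTypeII)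
    (hG : GradientTypeIOfTypeI) (hB : VorticitySparsenessLaw) :
    Theses.StretchingWellBinding.EnstrophyQuarterLaw := by
  intro ν T hν hT u p hmax hLH hdec
  obtain ⟨c₂, hc₂, hc₂', hBall⟩ := hB
  have hTI : IsTypeIBlowup u T := hII ν T hν hT u p hmax hLH hdec
  exact hS c₂ hc₂ hc₂' ν T hν hT u p hmax hLH hdec (hG ν T hν hT u p hmax hLH hdec hTI)
    (hBall ν T hν hT u p hmax hLH hdec)

/-- Converse at shelf level (real proof from the PROVED Chebyshev lemma): the quarter law forces B_ω at
every threshold. -/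
theorem vorticitySparse_of_enstrophyQuarterLaw (hE : Theses.StretchingWellBinding.EnstrophyQuarterLaw)
    {c₂ : ℝ} (hc₂ : 0 < c₂) :
    ∀ (ν T : ℝ), 0 < ν → 0 < T →
    ∀ (u : ℝ → EuclideanSpace ℝ (Fin 3) → EuclideanSpace ℝ (Fin 3)) (p : ℝ → EuclideanSpace ℝ (Fin 3) → ℝ),
      IsMaximalSmoothSolution ν 0 u p T → IsLerayHopfOn T ν 0 (u 0) u → HasRapidSpatialDecay (u 0) →
      VorticitySparse c₂ ν T u := by
  intro ν T hν hT u p hmax hLH hdec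
  exact vorticitySparse_of_sliceLaw hc₂ hν hmax (hE ν T hν hT u p hmax hLH hdec)

/-- Per-solution characterisation modulo the provable split and the known gradient rate (real proof):
for `c₂ ∈ (0,1/4)`, under the gradient Type-I rate, `SliceLaw ⟺ VorticitySparse c₂`. -/
theorem sliceLaw_iff (hS : StretchingSplit) {c₂ ν T : ℝ} (hc₂ : 0 < c₂) (hc₂' : c₂ < 1 / 4)
    (hν : 0 < ν) (hT : 0 < T)
    {u : ℝ → EuclideanSpace ℝ (Fin 3) → EuclideanSpace ℝ (Fin 3)} {p : ℝ → EuclideanSpace ℝ (Fin 3) → ℝ}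
    (hmax : IsMaximalSmoothSolution ν 0 u p T) (hLH : IsLerayHopfOn T ν 0 (u 0) u)
    (hdec : HasRapidSpatialDecay (u 0)) (hG : GradientTypeI T u) :
    SliceLaw T u ↔ VorticitySparse c₂ ν T u :=
  ⟨fun h => vorticitySparse_of_sliceLaw hc₂ hν hmax h,
   fun h => hS c₂ hc₂ hc₂' ν T hν hT u p hmax hLH hdec hG h⟩

/-- Registered-shape summary: the crux from the four stubs. -/
theorem enstrophyQuarterLaw_holds_of_stubs : Theses.StretchingWellBinding.EnstrophyQuarterLaw :=
  EnstrophyQuarterLaw_of stub_stretchingSplit stub_noTypeII stub_gradientTypeI stub_vorticitySparseness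

end Summit.NavierStokesRegularity.NavierStokesRegularity.Cruxes.EnstrophyQuarterLaw.LambBudget.Vorticity
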